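import Mathlib
import HarnessLib
import HarnessLib.Audit
import Summits.Parity.Statement
import HarnessLib.Audit.Status.Attr

/-!
Route: PolynomialKatai

DORMANT since 2026-08-24T11:45:57Z (reconciler: no traction for 6.7 d (last activity item-evidence-added at 2026-08-17T17:14:18Z); parked, not closed — `ledger route dormant route-Parity-PolynomialKatai --off` to reactivate) — unstaffed, not closed; items shared with open routes are served there. `ledger route dormant <id> --off` reactivates.

# Route PolynomialKatai — Kátai's criterion with polynomial primes — natural-density parity is
Chowla averaged over prime multipliers

BARRIER INVERSION (operator C) of the logarithmic-averaging wall. Tao's two-point theorem needs the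
log because it dilates the
VARIABLE, n ↦ pn (arXiv:1509.05422, p.3: "the logarithmic averaging allows us to leave the
constraint n ≤ x unchanged … we do not know
how to modify our argument to remove this averaging"). Dilate the SLOPE instead: for every prime p ≤
√N the class p ∣ n of the
two-point sum Z = Σ_{n≤N} λ(n)λ(n+h) is EXACTLY −Σ_{m≤N/p} λ(m)λ(pm+h) (complete multiplicativity,
λ(p) = −1) — top scale conserved,
no averaging of any kind — and by the arithmetic large sieve that class carries its fair share Z/p
for all primes outside a set of
Σ1/p ≤ 2/ε² (free typicality, true for EVERY bounded sequence). Hence natural-density two-point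
Chowla, uniformly over Green–Tao pair
systems (the crux ChowlaNatural of route LiouvilleOpening), FOLLOWS (support KataiTransfer, provable
now) from the door X =
PrimeMultiplierChowla: o(1) cancellation of the two-point sums Σ_u λ(u)λ(apu+Δ) on ℓ¹-AVERAGE OVER
PRIME MULTIPLIERS p ∈ (P,2P],
P anywhere in [N^δ, N^{1/4}] — Kátai–Bourgain–Sarnak–Ziegler with polynomial-size primes. With
LiouvilleOpening's PairLiouvilleLaw
(the Hardy–Littlewood error of a pair system is 𝔠_Ψ × its Chowla sum) this gives relative
Hardy–Littlewood pairs, and the shared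
residual RelativePairsToGHL carries pairs to the Statement.
Lean: `PrimeMultiplierChowla ∧ PairLiouvilleLaw ∧ RelativePairsToGHL`

## Assembly
Pure logic, sorry-free in Sketch.lean and glue.lean (lean check rc 0): `closes (hP :
PrimeMultiplierChowla) (hT : KataiTransfer)
(hLaw : PairLiouvilleLaw) (hRes : RelativePairsToGHL) : GeneralizedHardyLittlewood := hRes
(relativePairs_of hLaw (hT hP))`, where
relativePairs_of is LiouvilleOpening's twenty-line ε/2-bookkeeping (|S − 𝔠C| ≤ ε/2(1+s)N, |𝔠| ≤
K'(1+s), |C| ≤ εN/(2(K'+1)) ⇒ |S| ≤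
ε(1+s)N) with ChowlaNatural supplied as hT hP. Binders: three OPEN cruxes (PrimeMultiplierChowla,
PairLiouvilleLaw,
RelativePairsToGHL) + the provable-now support KataiTransfer; every binder occurs in the proof term.

Rationale: WHY THIS LINE. Assuming the catalogued walls, any route must (i) inject Λ/λ-specific bilinear
information (SelbergParityBarrier, PrimePairParity are proved schemas), (ii) reach NATURAL density
(Literature.Barriers.Parity.LogarithmicAveraging: no soft log→Cesàro transfer, tree theorems
not_logToMeanTransfer_bounded/_nonneg) and (iii) be Siegel-effective under shift-uniformity (tree:
not_generalizedHardyLittlewood_of_unboundedSiegelZeros). The door here is the weakest statement just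
outside (ii)'s hypothesis class: the transfer uses the exact dilation identity of λ at LARGE primes
p ∈ [N^δ, N^{1/4}] (not boundedness/positivity of the correlation sequence, and not Tao's small
primes), so the only open input left on the λ-side is an AVERAGE over ≍ P/log P prime multipliers of
two-point sums with one polynomially large slope — a dispersion-shaped object of the kind
Matomäki–Radziwiłł–Tao (arXiv:1503.05121, averaged over shifts), Klurman–Mangerel–Teräväinen
(arXiv:1909.12280, λ in short progressions to almost all moduli) and the LiouvilleShiftedTables
programme (stmt-Parity-14270, whose q = 1 table with C > 2 implies the a = k = 1 slice of the door
by Cauchy–Schwarz) attack, instead of pointwise natural-density Chowla, for which no tool exists.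
Imported: Kátai 1986 / Bourgain–Sarnak–Ziegler (Möbius-disjointness technology) and Elliott's
duality (dual Turán–Kubilius = large sieve at the zero class); nothing probabilistic or spectral.
What prior routes do not do: LiouvilleOpening files ChowlaNatural as a primitive crux with "no soft
transfer" (its Barriers line); LiouvilleShiftedTables uses its tables only as Type-II input for
Λ(n)λ(n−h) in progressions under EH; LiouvilleMAD/TwinMinorArcs average over shifts/minor arcs
(which never returns pointwise statements, MRT 2015); the closed cards free-dilation-transport
(known: common dilations are free and useless) and katai-propagation (bias export along shifted
primes) stop exactly before the one-sided dilation that changes the slope RATIO, which is the whole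
lever.

RANKED CRUXES. #0 RelativePairs (target) — relative Dickson–Hardy–Littlewood for PAIRS (shared
target of LiouvilleOpening, stmt-Parity-16146, verbatim): uniformly over non-degenerate d = 1 pair
systems with ‖Ψ‖_N ≤ L and convex K ⊆ [−N,N], |Σ_{n∈K}Λ(ψ₁(n))Λ(ψ₂(n)) − β_∞∏β_p| ≤ ε(1+|∏β_p|)N;
reached here as relativePairs_of(PairLiouvilleLaw, KataiTransfer PrimeMultiplierChowla) in
glue.lean. (why it might fail: shift-uniform hence Siegel-complete (MatomakiMerikoski2023 Thm 1.3 at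
h = 2q_exc); contains every fixed pair system's HL asymptotic.) [GreenTao2010,
MatomakiMerikoski2023, HardyLittlewood1923]
#2 PrimeMultiplierChowla (crux) — THE DOOR (Chowla on ℓ¹-average over prime multipliers of
polynomial size). For every L ≥ 1, ε > 0, δ > 0 and X ≥ X₀(L,ε,δ): for every P with X^δ ≤ P ≤
X^{1/4}, every dilation a ∈ ℤ with 1 ≤ |a| ≤ L, class modulus k ≤ L, shift Δ ≠ 0 with |Δ| ≤ LX, and
every choice of classes e(p) and intervals [lo(p), hi(p)] with hi(p)·P ≤ LX: Σ_{p prime ∈ (P,2P]}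
|Σ_{u ∈ [lo p, hi p], u ≡ e(p) (k)} λ(u)·λ(apu + Δ)| ≤ ε·X/log P (trivial ≍ L·X/log P). Each summand
is a two-point Chowla sum for the non-degenerate system (u, ap·u + Δ) with ONE slope of size ≍ P;
only the average over ≍ P/log P prime slopes is asked, with o(1) saving, at any ONE exponent range —
and it is all the λ-side parity input of the route. [difficulty: open-problem] (why it might fail:
Chowla-complete from below (KataiTransfer) and Siegel-complete in Δ: if λ pretends to χ (mod q) with
q ∣ Δ the complete sums Σ_u χ(u)χ(apu+Δ) = χ(ap)φ(q) do not cancel; every dual form (pencil over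
prime pairs, mean square over dilations) stays two-point — no MR-type terminal tool is known.)
[arXiv:1509.05422, arXiv:1503.05121, arXiv:1909.12280, Katai1986, BourgainSarnakZiegler2013,
TaoTeravainen2019AlmostAllScales, MatomakiMerikoski2023]
#3 PairLiouvilleLaw (crux) — PAIR LIOUVILLE LAW (shared crux of LiouvilleOpening, stmt-Parity-16147,
verbatim): uniformly over non-degenerate pair systems with ‖Ψ‖_N ≤ L and convex K ⊆ [−N,N], |𝔠_Ψ| ≤
K_L(1+|𝔖_Ψ|) and |Σ_{n∈K}Λ(ψ₁(n))Λ(ψ₂(n)) − β_∞𝔖_Ψ − 𝔠_Ψ·Σ_{n∈K}λ(ψ₁(n))λ(ψ₂(n))| ≤ ε(1+|𝔖_Ψ|)N, 𝔠_Ψ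
the Liouville cofactor constant: the Hardy–Littlewood error of a pair system IS 𝔠_Ψ times its Chowla
sum (Liouville opening at truncation N^{1/2+ε}, BV main terms, DFI balanced window,
RelativeChowlaLevel for the rest — LiouvilleOpening's support LawOfLevel). [difficulty:
open-problem] (why it might fail: rests on RelativeChowlaLevel (EH-shaped level N^(1−δ) for the
Chowla sequence, Siegel-complete) plus bookkeeping (𝔖-reassembly with the (b,d)-cut; convergence of
the λ-signed cofactor series, else limUnder is junk).) [MurtyVatwani2017, Vatwani2016,
DukeFriedlanderIwaniec1997, arXiv:1509.05422, Polymath8b2014]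
#5 RelativePairsToGHL (crux) — DECLARED RESIDUAL (shared with LiouvilleOpening, stmt-Parity-15917,
verbatim; complementary sector, staffed last): relative Hardy–Littlewood for pairs implies the
Statement — k-point parity for t ≥ 3, general d via the tree's PROVED fibration lemma, and the
absolute εN upgrade. The multiplier transfer extends verbatim to k-point Liouville correlations
(restrict to the class p ∣ ψ₁(n): one slope stays, k−1 slopes are multiplied by p), so the
natural-density k-point Chowla part of this residual is again a prime-multiplier average — recorded
in NOT DECOMPOSED YET, not filed. [deps: RelativePairs] [difficulty: open-problem] (why it might
fail: contains prime k-tuple parity for k ≥ 3 and the absolute upgrade on systems with ∏β_p ≍ (log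
log N); GHL-hard as typed; trivially implied BY the Statement (recorded: consequence used toward
S).) [GreenTao2010, Dickson1904, LichtmanTeravainen2022]
#9 ChowlaNatural (crux) — NODE (shared crux of LiouvilleOpening, stmt-Parity-16149, verbatim; on
this route it is the CONSEQUENT of KataiTransfer and the antecedent of relativePairs_of — not to be
staffed directly here): two-point Chowla–Elliott for λ along pairs of affine forms at natural
density, uniform over non-degenerate systems with ‖Ψ‖_N ≤ L and convex K ⊆ [−N,N]: |Σ_{n∈K∩ℤ}
λ(ψ₁(n))λ(ψ₂(n))| ≤ εN. [deps: PrimeMultiplierChowla] [difficulty: open-problem] (why it might fail: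
natural-density two-point Chowla is open (Tao 2016 log-averaged; TaoTeravainen2019 almost all
scales); shift-uniformity makes it Siegel-complete — on this route both features are inherited from
PrimeMultiplierChowla, from which it follows.) [arXiv:1509.05422, TaoTeravainen2019AlmostAllScales,
HelfgottRadziwill2021, Pilatte2026, arXiv:1503.05121]
#9 KataiTransfer (support) — THE LEVER, provable now (M/L): PrimeMultiplierChowla → ChowlaNatural.
Proof: for a non-degenerate pair system (a₁n+b₁, a₂n+b₂) (WLOG a₁ ≥ 1), |b_i| ≤ LN, interval K, put
z_n = λ⁺(ψ₁(n))λ⁺(ψ₂(n)) (λ⁺ = λ∘toNat). (1) Large sieve (tree: largeSieve_farey_hilbert) + Parseval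
mod p: Σ_{p≤√(2N+1)} p·Σ_c |Z(p,c) − Z/p|² ≤ 2(2N+1)², so the primes with |p·Z(p,c_p) − Z| > εN, c_p
the class p ∣ ψ₁(n), have Σ1/p ≤ 8/ε². (2) Identity: for p ∤ a₁, Z(p,c_p) = −λ(a₁)·Σ_{u∈I_p, u≡e_p
(a₁)} λ(u)λ⁺(a₂pu + Δ), Δ = a₁b₂ − a₂b₁ ≠ 0, I_p ⊆ [1, 3LN/p] an interval (λ(py) = −λ(y), λ(y/a₁) =
λ(a₁)λ(y)). (3) Chebyshev + Σ_{N^δ<p≤N^{1/4}}1/p ≥ c·log(1/4δ): some dyadic (P,2P] ⊂ [N^δ, N^{1/4}],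
δ = δ(ε), has bad mass ≤ ε·Σ_{p∼P}1/p. (4) Average the identity over good p with weights 1/p: |Z| ≤
(Σ_{p∼P}|D(p)|)/G + εN with G ≥ (1−ε)c/log P, and PrimeMultiplierChowla bounds the numerator by
ε'N/log P. [difficulty: provable-now] [Katai1986, BourgainSarnakZiegler2013, Elliott1997Duality,
Montgomery1978, arXiv:1509.05422]

TWO-LAYER PLAN. PrimeMultiplierChowla ⇐ TableRegime (|Δ| ≤ X/P: shifted-multiplication-table
geometry, Siegel-immune at fixed Δ) → GoldbachRegime
(X/P < |Δ| ≤ LX: descending tables λ(Δ − |a|pu), where the shift-uniform Siegel content lives) →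
PrimeMultiplierChowla (k = 2, by cases;
the BC3 skeleton bc/PrimeMultiplierChowla_birth.lean). Foreseen strengthening to attack first: the
mean square over dilations
DPMS: Σ_{m≤M, m≡r (k)} |Σ_{p∈(P₁,P₂]} λ(apm+Δ)|² ≤ π·M + ε(P/log P)²·X/P ("λ ⟂ dilated shifted
primes for almost every LARGE
dilation") — it implies the door by Cauchy–Schwarz and is implied, at (a,k) = (1,1) and fixed Δ, by
LiouvilleShiftedTables.TableChowla
with C > 2. PairLiouvilleLaw ⇐ LiouvilleOpening's LawOfLevel (RelativeChowlaLevel →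
PairLiouvilleLaw) — theirs, not re-filed.

KILL CRITERIA. ¬PrimeMultiplierChowla at a FIXED (a,k,Δ) (a structured family of ≫ P/log P prime
multipliers p with |Σ_u λ(u)λ(apu+Δ)| ≫ X/p)
refutes the door and, through KataiTransfer's contrapositive bookkeeping, exhibits an explicit
obstruction to two-point Chowla for
the system (u, apu+Δ) — close `refuted:PrimeMultiplierChowla` and file the family as a barrier
entry; a refutation only at Δ ≡ 0
mod a growing modulus (Siegel-type witness) is `refuted-misstated` and the repair is the fixed-Δ
door (then the route lands on
fixed-system Chowla and fixed-shift HL, Siegel-consistent, and the uniformity lift becomes the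
residual). A proof of ChowlaNatural
elsewhere moots crux 2; a proof of RelativePairs moots cruxes 2–3; refutation of PairLiouvilleLaw's
bookkeeping (junk limUnder) is
LiouvilleOpening's repair and is inherited. If KataiTransfer fails to formalise as stated (it is a
half-page argument from tree
theorems: largeSieve_farey_hilbert, Chebyshev, complete multiplicativity), the route is misfiled —
close `exhausted` with the Lean obstruction.

NOT DECOMPOSED YET. (i) The k-point transfer (t ≥ 3 part of the residual): class p ∣ ψ₁(n) turns Π_i
λ(ψ_i(n)) into −λ(a₁)·λ(u)Π_{i≥2}λ⁺((a_i p u + Δ_i)/a₁),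
so natural-density k-point Chowla ⇐ a k-point prime-multiplier average; not filed until the pair
door moves. (ii) DPMS (mean square over
dilations) and the prime-pair pencil Σ_{p≠p'}|Σ_u λ(apu+Δ)λ(ap'u+Δ)| (lines through (Δ,Δ) of slope
p'/p) — layer-2 strengthenings of
the door; the provable link TableChowla(C>2) ⇒ door(a=k=1, fixed Δ, hi ≥ P²) is a one-page
Cauchy–Schwarz a prover may land under
Theorems/ citing both routes. (iii) The fixed-Δ door (Siegel-immune: Σ_{u mod q}χ(u)χ(apu+Δ) ≪ √q
for q ∤ Δ) as the honest first
target; the uniformity in Δ ≤ LX is where Landau–Siegel must be paid (any GHL proof pays it: tree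
not_generalizedHardyLittlewood_of_unboundedSiegelZeros).
(iv) Constants: δ(ε) = (1/4)exp(−C/ε³) in KataiTransfer; the exponent 1/4 is not load-bearing (any
fixed θ < 1/2 works; smaller is weaker).

CHEAPEST FALSIFIER. RUN (kit j022191, X = 10⁷; j022188, X = 10⁸ queued at filing): (a) the identity
Z_{p,0} = −D(p) holds exactly for every prime tested;
(b) free typicality |p·Z_{p,0} − Z|/X over p ∈ (P,2P], P = X^{0.2,0.25,0.3}: median 1.7–2.3·10⁻³ =
random-model size √(p/X);
(c) the door ratio Σ_p|D(p)|/Σ_p(X/p) = 1.9–3.5·10⁻³ for h ∈ {1,2,6,30} against the random model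
(P/X)^{1/2} = 1.6–3.6·10⁻³, Goldbach
regime (a = −1, Δ = X, X−1) 1.6–2.5·10⁻³; (d) mean square over dilations / diagonal = 0.9965 (DPMS
predicts 1 + o(1), trivial 13).
The cheapest kill of the LINE is a literature one: a paper proving that prime-multiplier (or slope-)
averaged two-point Chowla is
EQUIVALENT to uniform-large-slope Chowla with no averaging discount (searched, not found;
free-dilation-transport's T2 covers common
dilations only). The cheapest kill of the LEVER: a Lean obstruction in KataiTransfer (none expected;
every input is a tree theorem).

NUMBERS. Door at X = 10⁷ (j022191): ratios 1.9·10⁻³ (h=1, P=25) … 3.5·10⁻³ (h=30, P=126) ≈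
(P/X)^{1/2}; typicality medians ≈ √(p/X). Transfer
constants: bad-prime mass ≤ 8/ε² (large sieve constant N+1+2Q² at Q = √(2N+1)); block choice needs
Σ_{N^δ<p≤N^{1/4}}1/p ≥ 9/ε³, i.e.
δ ≤ (1/4)e^{−C/ε³}. Door range P ∈ [X^δ, X^{1/4}], inner length ≤ LX/P ≥ L X^{3/4} ≥ P³ (table
regime b ≥ a² of stmt-Parity-14270, whose
window is A ∈ [x^δ, x^{1/3+δ}], δ ≤ 1/12, saving (log x)^{−C} ∀C; refuted sibling stmt-Parity-4218
had A up to x^{1/3+δ} uncapped).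
Items at open: 7 (target, 3 cruxes in closes, node ChowlaNatural, support KataiTransfer, assembly).

DEFINITION REQUESTS. None: AffLinForm, IsNondegenerateSystem, affLinSize, realBox, latticeBox,
realPoint, vonMangoldtSum, archFactor, singularProduct
(Literature.NumberTheory.Sieve), ArithmeticFunction.liouville / moebius, Nat.ModEq (Mathlib) — all
`lean search --decl`-checked via Sketch.lean (rc 0).

Novelty: Searches (2026-08-17): `lit search --source zbmath "Chowla conjecture Liouville" --year-from 2015`
(38 rows: Tao 2016, TT 2018/2019, MRT 2015/2016/2020/2023, Frantzikinakis(–Host), Helfgott–Radziwiłł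
via cards, Pilatte 2023, Krishnamoorthy 2025, Teräväinen 2024 — none reduces pointwise
natural-density Chowla to a multiplier/slope average); `lit read arxiv:1509.05422 --grep
Bourgain|Katai|bilinear|criterion` (4 hits; p.3–4 read: the variable dilation and "we do not know
how to … remove this averaging"); `lit read arxiv:1909.12280` (KMT Thms 1.1–1.5 read: almost-all
moduli, variance over classes — the 1-point shadow of the door); `lit read arxiv:2010.07924 --grep
Katai` (0), `arxiv:2501.10962` (0); `lit search --source zbmath "Liouville function at shifted
primes"` (1: Timofeev 1993); s2/openalex/arxiv APIs rate-limited (429) this session, local searchd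
reset (noted); `lean search "large.?sieve"` (63: largeSieve_farey_hilbert,
primeSum_mul_le_largeSieveSum — the tree inputs of KataiTransfer); all 34 Theses files of the sub,
the 121-card index (read in full: free-dilation-transport [known: Elliott duality],
katai-propagation / KataiPropagation [retired], monotone-sandwich-diagonal-entropy [declined],
affine-tree-harmonic-defect + addenda, lambda-twisted-dilation-identity), `ledger negatives
--problem Parity` (3; none of this shape), Cruxes/TableChowla/Disproof.lean (resists; (d)
TableChowla ⇐ uniform binary Chowla–Elliott).
Nearest prior art found: arXiv:1509.05422 (Tao 2016: sa  [refs: 1509.05422, 1909.12280, 2010.07924, 2501.10962, arxiv:1509.05422, arxiv:1909.12280, arxiv:2010.07924, arxiv:2501.10962, Katai1986, BourgainSarnakZiegler2013]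

Barriers (technique_class: katai-bsz large-sieve multiplier-average opening): - technique_class: katai-bsz large-sieve multiplier-average opening
- Literature.Barriers.Parity.LogarithmicAveraging: EVADED by construction — the wall
(not_logToMeanTransfer_bounded/_nonneg) forbids transfers that use only boundedness / non-negativity
/ O(X) partial sums of the correlation sequence; KataiTransfer uses the exact identity Z(p,c_p) =
−λ(a₁)D(p) (complete multiplicativity of λ at large primes), never a log average, and lands at
Cesàro density directly.
- Literature.Barriers.Parity.SelbergParityBarrier: not in the class — no lower bound from Type-I
data; the door is a bilinear (two-point, one large slope) λ-statement, false for Selberg's ghost by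
design.
- Literature.Barriers.Parity.PrimePairParity: the inputs are not weight-insertion invariant:
inserting ω = 1 − λ(n)λ(n+2) destroys the multiplicativity the identity uses; the Λ-side passage is
LiouvilleOpening's exact opening, an identity, not a monotone sieve deduction.
- Literature.Barriers.Parity.CircleMethodBinaryBarrier: no minor arcs anywhere on the λ-side; the
only Fourier analysis is Parseval mod p inside the large sieve (a complete sum).
- Literature.Barriers.Parity.CriticalDensityHalf: no dense model / transference; λ is used as a
completely multiplicative function, not as a dense set.
- Literature.Barriers.Parity.LargeSieveLevelHalf: the large sieve is used at Q = √N for typicality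
(lossless there, every sequence), never as a level-of-distribution engine beyond 1/2; the level
input of the Λ-passage is

History (route lifecycle, newest last):
- 2026-08-24T11:45:57Z · DORMANT — reconciler: no traction for 6.7 d (last activity item-evidence-added at 2026-08-17T17:14:18Z); parked, not closed — `ledger route dormant route-Parity-Polynomia (operator:999:3504748)

sub-problem: GeneralizedHardyLittlewood · status: dormant · opened planner-plan-novel-Parity-GeneralizedHardyLittl-03955878-c-v2-g16-0 2026-08-17T03:00:26Z · rev 1 · ledger route-Parity-PolynomialKatai
GENERATED by the gate from the ledger (D-0016/17). Provers cite these decls: `theorem foo : Summit.Parity.GeneralizedHardyLittlewood.Theses.PolynomialKatai.<Decl> := …` in Summits/Parity/GeneralizedHardyLittlewood/Theorems/<Name>.lean.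
-/

namespace Summit.Parity.GeneralizedHardyLittlewood.Theses.PolynomialKatai

open scoped BigOperators Topology Manifold Classical MeasureTheory ProbabilityTheory Matrix InnerProductSpace ComplexConjugate ContinuousMap
open Filter Set Function TopologicalSpace MeasureTheory

attribute [summit_statement] _root_.GeneralizedHardyLittlewood

/-- item stmt-Parity-16146 · target · rank 0 · open · by planner
why it might fail: shift-uniform hence Siegel-complete (MatomakiMerikoski2023 Thm 1.3 at h = 2q_exc); contains every fixed pair system's HL asymptotic.
sources: GreenTao2010, MatomakiMerikoski2023, HardyLittlewood1923
[target] relative Dickson–Hardy–Littlewood for PAIRS: uniformly over non-degenerate d = 1 systems of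
two forms with ‖Ψ‖_N ≤ L and convex K ⊆ [−N,N], |Σ_{n∈K}Λ(ψ₁(n))Λ(ψ₂(n)) − β_∞∏_pβ_p| ≤ ε(1 +
|∏_pβ_p|)N. Derived in glue.lean from PairLiouvilleLaw ∧ ChowlaNatural (theorem
relativePairs_of_law); contains every fixed pair system's Hardy–Littlewood asymptotic (twins, Sophie
Germain, Goldbach shapes) and is shift-uniform. -/
@[route_item "route-Parity-PolynomialKatai"]
def RelativePairs : Prop :=
  ∀ (L : ℕ) (ε : ℝ), 0 < ε → ∃ N₀ : ℕ, ∀ N : ℕ, N₀ ≤ N → ∀ Ψ : Fin 2 → Literature.NumberTheory.Sieve.AffLinForm 1, Literature.NumberTheory.Sieve.IsNondegenerateSystem Ψ → Literature.NumberTheory.Sieve.affLinSize Ψ N ≤ L → ∀ K : Set (Fin 1 → ℝ), Convex ℝ K → K ⊆ Literature.NumberTheory.Sieve.realBox 1 N → |Literature.NumberTheory.Sieve.vonMangoldtSum Ψ K N - Literature.NumberTheory.Sieve.archFactor Ψ K * Literature.NumberTheory.Sieve.singularProduct Ψ| ≤ ε * (1 + |Literature.NumberTheory.Sieve.singularProduct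 Ψ|) * (N : ℝ)

/-- item stmt-Parity-18777 · crux · rank 2 · open · by planner
why it might fail: Chowla-complete from below (KataiTransfer) and Siegel-complete in Δ: if λ pretends to χ (mod q) with q ∣ Δ the complete sums Σ_u χ(u)χ(apu+Δ) = χ(ap)φ(q) do not cancel; every dual form (pencil over prime pairs, mean square over dilations) stays two-point — no MR-type terminal tool is known.
sources: arXiv:1509.05422, arXiv:1503.05121, arXiv:1909.12280, Katai1986, BourgainSarnakZiegler2013, TaoTeravainen2019AlmostAllScales
[crux] THE DOOR (Chowla on ℓ¹-average over prime multipliers of polynomial size). For every L ≥ 1, ε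
> 0, δ > 0 and X ≥ X₀(L,ε,δ): for every P with X^δ ≤ P ≤ X^{1/4}, every dilation a ∈ ℤ with 1 ≤ |a|
≤ L, class modulus k ≤ L, shift Δ ≠ 0 with |Δ| ≤ LX, and every choice of classes e(p) and intervals
[lo(p), hi(p)] with hi(p)·P ≤ LX: Σ_{p prime ∈ (P,2P]} |Σ_{u ∈ [lo p, hi p], u ≡ e(p) (k)}
λ(u)·λ(apu + Δ)| ≤ ε·X/log P (trivial ≍ L·X/log P). Each summand is a two-point Chowla sum for the
non-degenerate system (u, ap·u + Δ) with ONE slope of size ≍ P; only the average over ≍ P/log P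
prime slopes is asked, with o(1) saving, at any ONE exponent range — and it is all the λ-side parity
input of the route. [difficulty: open-problem] -/
@[route_item "route-Parity-PolynomialKatai", crux]
def PrimeMultiplierChowla : Prop :=
  ∀ L : ℕ, 1 ≤ L → ∀ ε : ℝ, 0 < ε → ∀ δ : ℝ, 0 < δ → ∃ X₀ : ℕ, ∀ X : ℕ, X₀ ≤ X → ∀ P : ℕ, (X : ℝ) ^ δ ≤ (P : ℝ) → (P : ℝ) ≤ (X : ℝ) ^ (1 / 4 : ℝ) → ∀ a : ℤ, a ≠ 0 → |a| ≤ (L : ℤ) → ∀ k : ℕ, 1 ≤ k → k ≤ L → ∀ Δ : ℤ, Δ ≠ 0 → |Δ| ≤ (L : ℤ) * (X : ℤ) → ∀ e lo hi : ℕ → ℕ, (∀ p : ℕ, hi p * P ≤ L * X) → (∑ p ∈ (Finset.Ioc P (2 * P)).filter Nat.Prime, |∑ u ∈ (Finset.Icc (lo p) (hi p)).filter (fun u : ℕ => u ≡ e p [MOD k]), ((ArithmeticFunction.liouville u : ℤ) : ℝ) * ((ArithmeticFunction.liouville (Int.toNat ((a * p * u : ℤ) + Δ)) : ℤ) : ℝ)|)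 ≤ ε * (X : ℝ) / Real.log (P : ℝ)

/-- item stmt-Parity-16147 · crux · rank 3 · open · by planner
why it might fail: rests on RelativeChowlaLevel (EH-shaped level N^(1−δ) for the Chowla sequence, Siegel-complete) plus bookkeeping (𝔖-reassembly with the (b,d)-cut; convergence of the λ-signed cofactor series, else limUnder is junk).
sources: MurtyVatwani2017, Vatwani2016, DukeFriedlanderIwaniec1997, arXiv:1509.05422, Polymath8b2014
[crux] PAIR LIOUVILLE LAW: for every L there is K_L with, uniformly over non-degenerate pair systems
Ψ with ‖Ψ‖_N ≤ L and convex K ⊆ [−N,N]: |𝔠_Ψ| ≤ K_L(1+|𝔖_Ψ|) and |Σ_{n∈K}Λ(ψ₁(n))Λ(ψ₂(n)) − β_∞𝔖_Ψ −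
𝔠_Ψ·Σ_{n∈K}λ(ψ₁(n))λ(ψ₂(n))| ≤ ε(1+|𝔖_Ψ|)N, where 𝔠_Ψ = lim_y Σ_{k,l,b,d≤y} μ(k)μ(l)λ(b)λ(d) log b
log d·dens_Ψ(k²b, l²d) is the Liouville cofactor constant (an Euler product ζ(2)²∏_pH_p(Ψ); for (n,
n+2): (3/2)ζ(2) by the local computation in NOTES). The route's own claim: the Hardy–Littlewood
error of a pair system IS its Chowla sum times an explicit non-zero constant. [difficulty:
open-problem] -/
@[route_item "route-Parity-PolynomialKatai", crux]
def PairLiouvilleLaw : Prop :=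
  ∀ L : ℕ, ∃ Kc : ℝ, ∀ ε : ℝ, 0 < ε → ∃ N₀ : ℕ, ∀ N : ℕ, N₀ ≤ N → ∀ Ψ : Fin 2 → Literature.NumberTheory.Sieve.AffLinForm 1, Literature.NumberTheory.Sieve.IsNondegenerateSystem Ψ → Literature.NumberTheory.Sieve.affLinSize Ψ N ≤ L → |(Filter.limUnder Filter.atTop (fun y : ℕ => ∑ k ∈ Finset.Icc 1 y, ∑ l ∈ Finset.Icc 1 y, ∑ b ∈ Finset.Icc 1 y, ∑ d ∈ Finset.Icc 1 y, (ArithmeticFunction.moebius k : ℝ) * (ArithmeticFunction.moebius l : ℝ) * (ArithmeticFunction.liouville b : ℝ) * (ArithmeticFunction.liouville d : ℝ) * Real.log b * Real.log d * ((((Finset.range ((k ^ 2 * b) * (l ^ 2 * d))).filter fun r : ℕ => ((k ^ 2 * b : ℕ) : ℤ) ∣ (Ψ 0).eval (fun _ => (r : ℤ)) ∧ ((l ^ 2 * d : ℕ) : ℤ) ∣ (Ψ 1).eval (fun _ => (r : ℤ))).card : ℝ) / (((k ^ 2 * b) * (l ^ 2 * d) : ℕ) : ℝ))))| ≤ Kc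 * (1 + |Literature.NumberTheory.Sieve.singularProduct Ψ|) ∧ ∀ K : Set (Fin 1 → ℝ), Convex ℝ K → K ⊆ Literature.NumberTheory.Sieve.realBox 1 N → |Literature.NumberTheory.Sieve.vonMangoldtSum Ψ K N - Literature.NumberTheory.Sieve.archFactor Ψ K * Literature.NumberTheory.Sieve.singularProduct Ψ - (Filter.limUnder Filter.atTop (fun y : ℕ => ∑ k ∈ Finset.Icc 1 y, ∑ l ∈ Finset.Icc 1 y, ∑ b ∈ Finset.Icc 1 y, ∑ d ∈ Finset.Icc 1 y, (ArithmeticFunction.moebius k : ℝ) * (ArithmeticFunction.moebius l : ℝ) * (ArithmeticFunction.liouville b : ℝ) * (ArithmeticFunction.liouville d : ℝ) * Real.log b * Real.log d * ((((Finset.range ((k ^ 2 * b) * (l ^ 2 * d))).filter fun r : ℕ => ((k ^ 2 * b : ℕ) : ℤ) ∣ (Ψ 0).eval (fun _ => (r : ℤ)) ∧ ((l ^ 2 * d : ℕ) : ℤ) ∣ (Ψ 1).eval (fun _ => (r : ℤ))).card : ℝ) / (((k ^ 2 * b) * (l ^ 2 * d) : ℕ) : ℝ)))) * (∑ n ∈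 @Finset.filter (Fin 1 → ℤ) (fun n => Literature.NumberTheory.Sieve.realPoint n ∈ K) (Classical.decPred _) (Literature.NumberTheory.Sieve.latticeBox 1 N), ∏ i, ((ArithmeticFunction.liouville (Int.toNat ((Ψ i).eval n)) : ℤ) : ℝ))| ≤ ε * (1 + |Literature.NumberTheory.Sieve.singularProduct Ψ|) * (N : ℝ)

/-- item stmt-Parity-15917 · crux · rank 5 · open · by planner
why it might fail: contains prime k-tuple parity for k ≥ 3 and the absolute upgrade on systems with ∏β_p ≍ (log log N); GHL-hard as typed; trivially implied BY the Statement (recorded: consequence used toward S).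
sources: GreenTao2010, Dickson1904, LichtmanTeravainen2022
[crux] DECLARED RESIDUAL (complementary sector, not addressed by this mechanism and staffed last):
relative Dickson–Hardy–Littlewood for PAIRS implies the generalised Hardy–Littlewood conjecture in
full — content = (RelativePairs → DimOne: Dickson–Hardy–Littlewood at d = 1 for every t with
absolute error εN, i.e. higher-order parity for t ≥ 3 and the absolute upgrade on systems with ∏β_p
≍ log log N) composed with the tree's PROVED fibration lemma
`Summit.Parity.GeneralizedHardyLittlewood.Theorems.FibrationGlue.generalizedHardyLittlewood_of_dimOne
: DimOne → GeneralizedHardyLittlewood` (Theorems/LeeYangFibresFibrationLemmaFinal.lean) — a prover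
imports that file in the Theorems proof, never in this route file (cone repair rev 1: it replaces
RelativePairsToDimOne at the same strength given the tree). The same opening at truncation N^θ, tθ <
½, reduces the d = 1 part to k-point ChowlaNatural + RelativeChowlaLevel_k + multilinear Kloosterman
cores with λ-coefficients (shared in kind with DeterminantMoebiusCores.HigherCores) — not filed now.
[deps: RelativePairs] [difficulty: open-problem] -/
@[route_item "route-Parity-PolynomialKatai", crux]
def RelativePairsToGHL : Prop :=
  RelativePairs → _root_.GeneralizedHardyLittlewood

/-- item stmt-Parity-16149 · crux · rank 9 · open · by planner
why it might fail: natural-density two-point Chowla is open (Tao 2016 log-averaged; TaoTeravainen2019 almost all scales); shift-uniformity makes it Siegel-complete — on this route both features are inherited from PrimeMultiplierChowla, from which it follows.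
sources: arXiv:1509.05422, TaoTeravainen2019AlmostAllScales, HelfgottRadziwill2021, Pilatte2026, arXiv:1503.05121
[crux] two-point Chowla–Elliott for λ along PAIRS OF AFFINE FORMS at natural density, uniform over
non-degenerate systems with ‖Ψ‖_N ≤ L and convex K ⊆ [−N,N]: |Σ_{n∈K∩ℤ} λ(ψ₁(n))λ(ψ₂(n))| ≤ εN for N
≥ N₀(L,ε). The route's ENTIRE parity input (it fails for the Liouville ghost by design); its
logarithmically averaged fixed-system form is Tao's theorem, its odd-order analogues hold at natural
density. [difficulty: open-problem] -/
@[route_item "route-Parity-PolynomialKatai"]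
def ChowlaNatural : Prop :=
  ∀ (L : ℕ) (ε : ℝ), 0 < ε → ∃ N₀ : ℕ, ∀ N : ℕ, N₀ ≤ N → ∀ Ψ : Fin 2 → Literature.NumberTheory.Sieve.AffLinForm 1, Literature.NumberTheory.Sieve.IsNondegenerateSystem Ψ → Literature.NumberTheory.Sieve.affLinSize Ψ N ≤ L → ∀ K : Set (Fin 1 → ℝ), Convex ℝ K → K ⊆ Literature.NumberTheory.Sieve.realBox 1 N → |(∑ n ∈ @Finset.filter (Fin 1 → ℤ) (fun n => Literature.NumberTheory.Sieve.realPoint n ∈ K) (Classical.decPred _) (Literature.NumberTheory.Sieve.latticeBox 1 N), ∏ i, ((ArithmeticFunction.liouville (Int.toNat ((Ψ i).eval n)) : ℤ) : ℝ))| ≤ ε * (N : ℝ)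

/-- item stmt-Parity-18778 · support · rank 9 · open · by planner
sources: Katai1986, BourgainSarnakZiegler2013, Elliott1997Duality, Montgomery1978, arXiv:1509.05422
[support] THE LEVER, provable now (M/L): PrimeMultiplierChowla → ChowlaNatural. Proof: for a
non-degenerate pair system (a₁n+b₁, a₂n+b₂) (WLOG a₁ ≥ 1), |b_i| ≤ LN, interval K, put z_n =
λ⁺(ψ₁(n))λ⁺(ψ₂(n)) (λ⁺ = λ∘toNat). (1) Large sieve (tree: largeSieve_farey_hilbert) + Parseval mod
p: Σ_{p≤√(2N+1)} p·Σ_c |Z(p,c) − Z/p|² ≤ 2(2N+1)², so the primes with |p·Z(p,c_p) − Z| > εN, c_p the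
class p ∣ ψ₁(n), have Σ1/p ≤ 8/ε². (2) Identity: for p ∤ a₁, Z(p,c_p) = −λ(a₁)·Σ_{u∈I_p, u≡e_p (a₁)}
λ(u)λ⁺(a₂pu + Δ), Δ = a₁b₂ − a₂b₁ ≠ 0, I_p ⊆ [1, 3LN/p] an interval (λ(py) = −λ(y), λ(y/a₁) =
λ(a₁)λ(y)). (3) Chebyshev + Σ_{N^δ<p≤N^{1/4}}1/p ≥ c·log(1/4δ): some dyadic (P,2P] ⊂ [N^δ, N^{1/4}],
δ = δ(ε), has bad mass ≤ ε·Σ_{p∼P}1/p. (4) Average the identity over good p with weights 1/p: |Z| ≤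
(Σ_{p∼P}|D(p)|)/G + εN with G ≥ (1−ε)c/log P, and PrimeMultiplierChowla bounds the numerator by
ε'N/log P. [difficulty: provable-now] -/
@[route_item "route-Parity-PolynomialKatai", crux]
def KataiTransfer : Prop :=
  PrimeMultiplierChowla → ChowlaNatural

/-- item stmt-Parity-18779 · assembly · rank 1 · open · by planner
sources: GreenTao2010, arXiv:1509.05422
[assembly] PrimeMultiplierChowla → KataiTransfer → PairLiouvilleLaw → RelativePairsToGHL →
GeneralizedHardyLittlewood. -/
@[route_item "route-Parity-PolynomialKatai"]
def Assembly : Prop :=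
  PrimeMultiplierChowla → KataiTransfer → PairLiouvilleLaw → RelativePairsToGHL → _root_.GeneralizedHardyLittlewood

/-! D-0027 §2.1 — DECIDING THEOREM (planner-authored via `route open/edit --closes-file`; by planner-plan-novel-Parity-GeneralizedHardyLittl-03955878-c-v 2026-08-17T03:00:26Z):
its hypotheses are this route's items and its conclusion the sub-problem Statement (glue_lint), and it elaborates with this file. -/

@[closes "route-Parity-PolynomialKatai"] theorem closes (hP : PrimeMultiplierChowla) (hT : KataiTransfer) (hLaw : PairLiouvilleLaw)
    (hRes : RelativePairsToGHL) : _root_.GeneralizedHardyLittlewood := by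
  -- ChowlaNatural from the door by the (provable-now) multiplier transfer
  have hCh : ChowlaNatural := hT hP
  -- LiouvilleOpening's ε/2 bookkeeping: PairLiouvilleLaw ∧ ChowlaNatural ⇒ RelativePairs
  have key : ∀ (S c C s N ε K' : ℝ), 0 ≤ s → 0 ≤ N → 0 < ε → 0 ≤ K' →
      |c| ≤ K' * (1 + s) → |S - c * C| ≤ ε / 2 * (1 + s) * N →
      |C| ≤ ε / (2 * (K' + 1)) * N → |S| ≤ ε * (1 + s) * N := by
    intro S c C s N ε K' hs hN hε hK' hc h1 h2
    have htri : |S| ≤ |S - c * C| + |c| * |C| := by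
      calc |S| = |(S - c * C) + c * C| := by ring_nf
        _ ≤ |S - c * C| + |c * C| := abs_add_le _ _
        _ = |S - c * C| + |c| * |C| := by rw [abs_mul]
    have hcC : |c| * |C| ≤ K' * (1 + s) * (ε / (2 * (K' + 1)) * N) :=
      mul_le_mul hc h2 (abs_nonneg _) (by positivity)
    have hK1 : K' / (K' + 1) ≤ 1 := by
      rw [div_le_one (by positivity)]; linarith
    calc |S| ≤ |S - c * C| + |c| * |C| := htri
      _ ≤ ε / 2 * (1 + s) * N + K' * (1 + s) * (ε / (2 * (K' + 1)) * N) := add_le_add h1 hcC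
      _ = ε / 2 * (1 + s) * N + (K' / (K' + 1)) * (ε / 2 * (1 + s) * N) := by
          field_simp
      _ ≤ ε / 2 * (1 + s) * N + 1 * (ε / 2 * (1 + s) * N) := by
          gcongr
      _ = ε * (1 + s) * N := by ring
  have hRP : RelativePairs := by
    intro L ε hε
    obtain ⟨Kc, hK⟩ := hLaw L
    set K' : ℝ := max Kc 0 with hK'def
    have hK'0 : 0 ≤ K' := le_max_right _ _
    have hKle : Kc ≤ K' := le_max_left _ _
    obtain ⟨N₁, hN₁⟩ := hK (ε / 2) (by positivity)
    obtain ⟨N₂, hN₂⟩ := hCh L (ε / (2 * (K' + 1))) (by positivity)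
    refine ⟨max N₁ N₂, fun N hN Ψ hΨ hL K hKc hKN => ?_⟩
    obtain ⟨hc, hlaw⟩ := hN₁ N (le_of_max_le_left hN) Ψ hΨ hL
    have h1 := hlaw K hKc hKN
    have h2 := hN₂ N (le_of_max_le_right hN) Ψ hΨ hL K hKc hKN
    set s := |Literature.NumberTheory.Sieve.singularProduct Ψ| with hsdef
    have hs0 : 0 ≤ s := abs_nonneg _
    have hN0 : (0 : ℝ) ≤ N := Nat.cast_nonneg N
    have hc' := hc.trans
      (mul_le_mul_of_nonneg_right hKle (by positivity) : Kc * (1 + s) ≤ K' * (1 + s))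
    exact key _ _ _ s N ε K' hs0 hN0 hε hK'0 hc' h1 h2
  exact hRes hRP

end Summit.Parity.GeneralizedHardyLittlewood.Theses.PolynomialKatai
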